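import Summits.ABC.IUTFork.Thm311RealInd1StripHullIdeals
import Summits.ABC.IUTFork.Thm311RealInd1StripGenuineK
import HarnessLib

/-!
# [IUTchIII] Thm 3.11 (i) (Ind1)+(Ind2) at `v ∈ 𝕍^non`: the `𝒪_{K_v}`-hull of THE print-(Ind1)⊔(Ind2) orbit span of an ideal-shaped region IS
# the container's (modulo `JannsenWingbergMappingClass`; tame, odd local degree `≥ 3`)

PROOF-ONLY file (abc-iut cell, Cor. 3.12 sub-crew, seat abc-iut-c312-1 = holder of record of the typed [IUTchIII] Thm. 3.11, gen 15; row
«R19 = C:IND1-STRIP-OV-HULL», C LEAD ruling C-R120 (c); file 4 — the orbit-span instance of `Thm311RealInd1StripHullIdeals`).  TAKES NO SIDE on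
[IUTchIII] Cor. 3.12.

* **`coe_span_closure_orbit_eq_of_ball_of_jannsenWingbergMappingClass`** — for the ball `M = {x : ‖x‖ ≤ ‖c‖·p^{−n/e}}` (`= c·𝔪_v^n`; `c ≠ 0`,
  `1 ≤ n ≤ e`, NOT (`n = e` ∧ `f(v|p) = 1`)) the ADDITIVE SPAN of its two-step print-(Ind1) strip orbit — `AddSubgroup.closure` of `M`, `ψ(M)`,
  `ψ'(ψ(M))` over `ψ, ψ' ∈ Real.ind1StripOf v (galoisLog v)` — lies inside the ceiling `M + (c·log_p(𝒪_v^×) ∩ Ker Tr)` UNCONDITIONALLY (R17b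
  `sub_mem_smul_logUnits_inter_ker_trace_of_mem_ind1StripOf`, twice), so `coe_span_eq_of_ball_of_jannsenWingbergMappingClass` applies to it: its
  `𝒪_{K_v}`-module hull EQUALS the hull of Dupuy–Hilado's container span `c·log_p(𝒪_v^×)` = `closedBall 0 (‖c‖·p^{−1/e})` (`= c·𝔪_v`).  (The
  span of the FULL orbit under the group generated by `Real.ind1Strip ∪ Real.ismIsm` is sandwiched between this one and the same ceiling,
  p516833 §1, hence has the same hull.)
* `coe_span_closure_orbit_eq_at_bad_of_jannsenWingbergMappingClass` — the JUNCTION with [IUTchI] Def. 3.1: at a BAD place `w` of a genuine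
  initial Θ-datum (abc-iut-L5-t2 `InitialThetaData`, abc-iut-C-cert-3 `pilotDataOfK`; R16: `p ≠ 2` and `[K_w:ℚ_p] ≥ 5` automatic, indeed
  `5 ≤ l ≤ e(w|p)`), IF `w` is tame (`e(w|p) ≤ p − 2`) and of odd local degree, the same identity for every `c·𝔪_w^n` off the one residue.
READING as in `Thm311RealInd1StripHullIdeals`: modulo the Jannsen–Wingberg presentation with Kondo's mapping-class-group image, at a tame place of
odd local degree `≥ 3`, print's (Ind1) strip part AS TYPED inflates the holomorphic hull of `c·𝔪_v^n` to the container's `c·𝔪_v` (gain `n − 1`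
steps), except possibly `n = e` at `f(v|p) = 1`.  HONEST SCOPE: conditional on `hMC`; single place; tame; odd local degree; OUR typing of print's
(Ind1) (THE equivariant lift, THE logarithm; F-B28-1 untouched); no log-volume or tensor-packet hull computed; no side taken on [IUTchIII]
Cor. 3.12; NO abc claim. [claim: Mochizuki2012, status: disputed]; [cite: Mochizuki2012, IUTchIII Thm. 3.11 (i) p. 154; Rmk. 3.9.5 (i) p. 126;
Cor. 3.12 Step (xi) p. 183]; [cite: Kondo2025OuterAutMLF, §3 Thm 3.17, Rem 3.18]; [cite: DupuyHilado2025, §4.9, §4.12]. typed ≠ proved;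
a conditional theorem discharges nothing it binds.
-/

set_option autoImplicit false

noncomputable section

open Metric Set
open scoped Pointwise

namespace Summit.ABC.IUTFork.Thm311.Real

open NumberField IsDedekindDomain Literature.NumberTheory.NumberFields Literature.IUT.LogVolume
open Literature.NumberTheory.GaloisRepresentations Literature.NumberTheory.GaloisRepresentations.Ultrametric
open Literature.AnabelianGeometry.AbsoluteAnabelian Literature.IUT.HodgeArakelov
open Literature.IUT.HodgeArakelov.AbsTopMonoids

variable {F : Type} [Field F] [NumberField F] (v : HeightOneSpectrum (𝓞 F))

/-- **THE `𝒪_{K_v}`-HULL OF THE PRINT-(Ind1)⊔(Ind2) ORBIT SPAN OF AN IDEAL IS THE CONTAINER's (modulo `JannsenWingbergMappingClass`).**  At a tame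
place `v ∣ p` (`p > 2`, `e(v|p) ≤ p − 2`) of ODD local degree `≥ 3`, for `c ≠ 0`, `1 ≤ n ≤ e`, NOT (`n = e` ∧ `f(v|p) = 1`): the additive span of
the two-step strip orbit of the ball `{x : ‖x‖ ≤ ‖c‖·p^{−n/e}}` (`= c·𝔪_v^n`) — which lies inside the ceiling UNCONDITIONALLY (R17b) — has
`𝒪_{K_v}`-module hull EQUAL to that of Dupuy–Hilado's container span `c·log_p(𝒪_v^×)`, the ball of radius `‖c‖·p^{−1/e}` (`= c·𝔪_v`).
[claim: Mochizuki2012, status: disputed] [cite: Mochizuki2012, IUTchIII Thm. 3.11 (i) p. 154; Rmk. 3.9.5 (i) p. 126; Cor. 3.12 Step (xi) p. 183]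
[cite: Kondo2025OuterAutMLF, §3 Thm 3.17, Rem 3.18] [cite: DupuyHilado2025, §4.9, §4.12] -/
theorem coe_span_closure_orbit_eq_of_ball_of_jannsenWingbergMappingClass (hMC : JannsenWingbergMappingClass)
    (p : ℕ) [Fact p.Prime] (hv : ((p : ℕ) : 𝓞 F) ∈ v.asIdeal) (hp2 : 2 < p)
    (he : absRamificationIdx p (RescaledCompletion F p v hv) ≤ p - 2) (h3 : 3 ≤ localDeg F v) (hodd : Odd (localDeg F v))
    {c : ℚ_[p]} (hc : c ≠ 0) {n : ℕ} (hn1 : 1 ≤ n) (hne : n ≤ absRamificationIdx p (RescaledCompletion F p v hv))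
    (hexc : ¬ (n = absRamificationIdx p (RescaledCompletion F p v hv) ∧ v.asIdeal.inertiaDeg ℤ = 1)) :
    let r : ℝ := ‖c‖ * (p : ℝ) ^ (-((n : ℝ) / (absRamificationIdx p (RescaledCompletion F p v hv) : ℝ)))
    let M : Set (v.adicCompletion F) := {x | ‖RescaledCompletion.of F p v hv x‖ ≤ r}
    let N : AddSubgroup (RescaledCompletion F p v hv) := AddSubgroup.closure
      (RescaledCompletion.of F p v hv '' M ∪
        ((⋃ ψ ∈ ind1StripOf v (galoisLog v), (fun x => RescaledCompletion.of F p v hv (ψ x)) '' M) ∪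
          ⋃ ψ ∈ ind1StripOf v (galoisLog v), ⋃ ψ' ∈ ind1StripOf v (galoisLog v),
            (fun x => RescaledCompletion.of F p v hv (ψ' (ψ x))) '' M))
    (Submodule.span (Valued.integer (RescaledCompletion F p v hv)) (N : Set (RescaledCompletion F p v hv)) :
        Set (RescaledCompletion F p v hv)) =
      Submodule.span (Valued.integer (RescaledCompletion F p v hv)) (c • logUnits (RescaledCompletion F p v hv)) ∧
    (Submodule.span (Valued.integer (RescaledCompletion F p v hv)) (c • logUnits (RescaledCompletion F p v hv)) :
        Set (RescaledCompletion F p v hv)) =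
      closedBall 0 (‖c‖ * (p : ℝ) ^ (-(1 / (absRamificationIdx p (RescaledCompletion F p v hv) : ℝ)))) := by
  intro r M N
  set R := RescaledCompletion F p v hv
  set e := RescaledCompletion.of F p v hv with he_def
  set E := absRamificationIdx p (RescaledCompletion F p v hv) with hE_def
  have hP : p.Prime := Fact.out
  have hp1 : (1 : ℝ) < p := by exact_mod_cast hP.one_lt
  have hE0' : (0 : ℝ) < E := by exact_mod_cast absRamificationIdx_pos p R
  have hc0 : 0 < ‖c‖ := norm_pos_iff.mpr hc
  -- `M ⊆ c·log_p(𝒪_v^×)` (tame: `log_p = {‖z‖ < 1}`, and `p^{-n/E} < 1`)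
  have hpn : (p : ℝ) ^ (-((n : ℝ) / (E : ℝ))) < 1 :=
    Real.rpow_lt_one_of_one_lt_of_neg hp1 (by
      have : (0 : ℝ) < (n : ℝ) / E := div_pos (by exact_mod_cast hn1) hE0'
      linarith)
  have hMc : ∀ x ∈ M, e x ∈ c • logUnits R := by
    intro x hx
    refine ⟨c⁻¹ • e x, (mem_logUnits_iff_norm_lt_one_of_tame p hp2 he _).mpr ?_,
      by change c • (c⁻¹ • e x) = e x; rw [smul_smul, mul_inv_cancel₀ hc, one_smul]⟩
    rw [norm_smul, norm_inv, inv_mul_lt_iff₀ hc0]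
    calc ‖e x‖ ≤ r := hx
      _ < ‖c‖ * 1 := mul_lt_mul_of_pos_left hpn hc0
  -- bookkeeping on `c·log_p ∩ Ker Tr`
  have hCadd : ∀ a b : R, a ∈ c • logUnits R → b ∈ c • logUnits R → a + b ∈ c • logUnits R := by
    intro a b ha hb
    obtain ⟨a', ha', rfl⟩ := Set.mem_smul_set.mp ha
    obtain ⟨b', hb', rfl⟩ := Set.mem_smul_set.mp hb
    rw [← smul_add]
    exact Set.smul_mem_smul_set ((logUnitsAddSubgroup p R).add_mem (show a' ∈ logUnitsAddSubgroup p R from ha')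
      (show b' ∈ logUnitsAddSubgroup p R from hb'))
  -- the ceiling as an additive subgroup
  let B : AddSubgroup R :=
    { carrier := {x | ‖x‖ ≤ r}
      add_mem' := fun {a b} ha hb => (IsUltrametricDist.norm_add_le_max a b).trans (max_le ha hb)
      zero_mem' := by change ‖(0 : R)‖ ≤ r; rw [norm_zero]; positivity
      neg_mem' := fun {a} ha => by change ‖-a‖ ≤ r; rw [norm_neg]; exact ha }
  let C : AddSubgroup R :=
    { carrier := c • logUnits R ∩ {w | Algebra.trace ℚ_[p] R w = 0}
      add_mem' := fun {a b} ha hb => ⟨hCadd a b ha.1 hb.1, by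
        change Algebra.trace ℚ_[p] R (a + b) = 0
        rw [map_add, show Algebra.trace ℚ_[p] R a = 0 from ha.2, show Algebra.trace ℚ_[p] R b = 0 from hb.2, add_zero]⟩
      zero_mem' := ⟨by rw [← smul_zero c]; exact Set.smul_mem_smul_set (zero_mem_logUnits (p := p)), by
        change Algebra.trace ℚ_[p] R 0 = 0; rw [map_zero]⟩
      neg_mem' := fun {a} ha => ⟨by
        obtain ⟨a', ha', rfl⟩ := Set.mem_smul_set.mp ha.1
        rw [← smul_neg]
        exact Set.smul_mem_smul_set ((logUnitsAddSubgroup p R).neg_mem (show a' ∈ logUnitsAddSubgroup p R from ha')), by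
        change Algebra.trace ℚ_[p] R (-a) = 0
        rw [map_neg, show Algebra.trace ℚ_[p] R a = 0 from ha.2, neg_zero]⟩ }
  have hBC : ((B ⊔ C : AddSubgroup R) : Set R) = {x | ‖x‖ ≤ r} + (c • logUnits R ∩ {w | Algebra.trace ℚ_[p] R w = 0}) :=
    AddSubgroup.add_normal B C
  have heM : e '' M = {x : R | ‖x‖ ≤ r} := by
    ext x
    constructor
    · rintro ⟨x', hx', rfl⟩; exact hx'
    · intro hx; exact ⟨e.symm x, by change ‖e (e.symm x)‖ ≤ r; rwa [RingEquiv.apply_symm_apply], e.apply_symm_apply x⟩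
  -- one strip step stays in the ceiling (R17b, UNCONDITIONAL)
  have hstep : ∀ ψ ∈ ind1StripOf v (galoisLog v), ∀ z : v.adicCompletion F, e z ∈ c • logUnits R →
      e (ψ z) - e z ∈ (C : Set R) ∧ e (ψ z) ∈ c • logUnits R := by
    intro ψ hψ z hz
    have h := sub_mem_smul_logUnits_inter_ker_trace_of_mem_ind1StripOf v p hv hψ c hz
    refine ⟨⟨h.1, h.2⟩, ?_⟩
    have := hCadd _ _ h.1 hz
    rwa [sub_add_cancel] at this
  have hNc : (N : Set R) ⊆ {x | ‖x‖ ≤ r} + (c • logUnits R ∩ {w | Algebra.trace ℚ_[p] R w = 0}) := by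
    rw [← hBC]
    refine (AddSubgroup.closure_le (B ⊔ C)).mpr ?_
    rintro g (⟨x, hx, rfl⟩ | hg | hg)
    · exact AddSubgroup.mem_sup_left hx
    · simp only [Set.mem_iUnion, Set.mem_image] at hg
      obtain ⟨ψ, hψ, x, hx, rfl⟩ := hg
      have h1 := hstep ψ hψ x (hMc x hx)
      have hsum : e (ψ x) = e x + (e (ψ x) - e x) := by abel
      rw [hsum]
      exact (B ⊔ C).add_mem (AddSubgroup.mem_sup_left hx) (AddSubgroup.mem_sup_right h1.1)
    · simp only [Set.mem_iUnion, Set.mem_image] at hg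
      obtain ⟨ψ, hψ, ψ', hψ', x, hx, rfl⟩ := hg
      have h1 := hstep ψ hψ x (hMc x hx)
      have h2 := hstep ψ' hψ' (ψ x) h1.2
      have hsum : e (ψ' (ψ x)) = e x + ((e (ψ' (ψ x)) - e (ψ x)) + (e (ψ x) - e x)) := by abel
      rw [hsum]
      exact (B ⊔ C).add_mem (AddSubgroup.mem_sup_left hx) (AddSubgroup.mem_sup_right (C.add_mem h2.1 h1.1))
  refine coe_span_eq_of_ball_of_jannsenWingbergMappingClass v hMC p hv hp2 he h3 hodd hc hn1 hne hexc N
    (fun x hx => AddSubgroup.subset_closure (Or.inl ⟨x, hx, rfl⟩)) (fun ψ hψ x hx => ⟨?_, fun ψ' hψ' => ?_⟩) hNc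
  · refine AddSubgroup.subset_closure (Or.inr (Or.inl ?_))
    simp only [Set.mem_iUnion, Set.mem_image]
    exact ⟨ψ, hψ, x, hx, rfl⟩
  · refine AddSubgroup.subset_closure (Or.inr (Or.inr ?_))
    simp only [Set.mem_iUnion, Set.mem_image]
    exact ⟨ψ, hψ, ψ', hψ', x, hx, rfl⟩

/-! ## At the BAD places of a genuine initial Θ-datum ([IUTchI] Def. 3.1) -/

section GenuineK

open Literature.IUT.HodgeTheaters Cor312Prov

variable {K₀ Fbar : Type} [Field K₀] [NumberField K₀] [Algebra F K₀] [Field Fbar]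
  [Algebra F Fbar] [Algebra K₀ Fbar] {E : WeierstrassCurve F} [E.IsElliptic] {l : ℕ} {Pb : BadPlacePredicates K₀}
  (D : InitialThetaData F K₀ Fbar E l Pb)

/-- **JUNCTION WITH [IUTchI] Def. 3.1: the hull identity at every TAME bad place of odd local degree of a genuine initial Θ-datum** (modulo
`JannsenWingbergMappingClass`).  For a place `w` in the bad set of the `K`-level Dupuy–Hilado pilot datum of an initial Θ-datum `D` (`p ≠ 2` and
`[K_w:ℚ_p] ≥ 5` are AUTOMATIC, R16; indeed `5 ≤ l ≤ e(w|p)`), IF `e(w|p) ≤ p − 2` and `[K_w:ℚ_p]` is odd: for every content `c ≠ 0` and depth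
`1 ≤ n ≤ e(w|p)` off the residue (`n = e ∧ f(w|p) = 1`), the `𝒪_{K_w}`-hull of the two-step print-(Ind1) strip orbit span of `c·𝔪_w^n` is the
container's `c·𝔪_w`. [claim: Mochizuki2012, status: disputed] [cite: Mochizuki2012, IUTchI Def. 3.1 p. 61; IUTchIII Thm. 3.11 (i) p. 154]
[cite: DupuyHilado2025, §3.3, §4.9, §4.12] -/
theorem coe_span_closure_orbit_eq_at_bad_of_jannsenWingbergMappingClass (hMC : JannsenWingbergMappingClass)
    {w : HeightOneSpectrum (𝓞 K₀)} (hS : w ∈ (pilotDataOfK D K₀).S)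
    (p : ℕ) [Fact p.Prime] (hw : ((p : ℕ) : 𝓞 K₀) ∈ w.asIdeal)
    (he : absRamificationIdx p (RescaledCompletion K₀ p w hw) ≤ p - 2) (hodd : Odd (localDeg K₀ w))
    {c : ℚ_[p]} (hc : c ≠ 0) {n : ℕ} (hn1 : 1 ≤ n) (hne : n ≤ absRamificationIdx p (RescaledCompletion K₀ p w hw))
    (hexc : ¬ (n = absRamificationIdx p (RescaledCompletion K₀ p w hw) ∧ w.asIdeal.inertiaDeg ℤ = 1)) :
    let r : ℝ := ‖c‖ * (p : ℝ) ^ (-((n : ℝ) / (absRamificationIdx p (RescaledCompletion K₀ p w hw) : ℝ)))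
    let M : Set (w.adicCompletion K₀) := {x | ‖RescaledCompletion.of K₀ p w hw x‖ ≤ r}
    let N : AddSubgroup (RescaledCompletion K₀ p w hw) := AddSubgroup.closure
      (RescaledCompletion.of K₀ p w hw '' M ∪
        ((⋃ ψ ∈ ind1StripOf w (galoisLog w), (fun x => RescaledCompletion.of K₀ p w hw (ψ x)) '' M) ∪
          ⋃ ψ ∈ ind1StripOf w (galoisLog w), ⋃ ψ' ∈ ind1StripOf w (galoisLog w),
            (fun x => RescaledCompletion.of K₀ p w hw (ψ' (ψ x))) '' M))
    5 ≤ localDeg K₀ w ∧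
    (Submodule.span (Valued.integer (RescaledCompletion K₀ p w hw)) (N : Set (RescaledCompletion K₀ p w hw)) :
        Set (RescaledCompletion K₀ p w hw)) =
      Submodule.span (Valued.integer (RescaledCompletion K₀ p w hw)) (c • logUnits (RescaledCompletion K₀ p w hw)) ∧
    (Submodule.span (Valued.integer (RescaledCompletion K₀ p w hw)) (c • logUnits (RescaledCompletion K₀ p w hw)) :
        Set (RescaledCompletion K₀ p w hw)) =
      closedBall 0 (‖c‖ * (p : ℝ) ^ (-(1 / (absRamificationIdx p (RescaledCompletion K₀ p w hw) : ℝ)))) := by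
  intro r M N
  have h5 := five_le_localDeg_of_mem_S_pilotDataOfK D hS
  have hp2 : 2 < p := lt_of_le_of_ne (Fact.out : p.Prime).two_le (residueChar_ne_two_of_mem_S_pilotDataOfK D hS hw).symm
  exact ⟨h5, coe_span_closure_orbit_eq_of_ball_of_jannsenWingbergMappingClass w hMC p hw hp2 he
    ((show 3 ≤ 5 by norm_num).trans h5) hodd hc hn1 hne hexc⟩

end GenuineK

end Summit.ABC.IUTFork.Thm311.Real

end
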